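import Mathlib.Algebra.Category.Grp.Injective
import Mathlib.FieldTheory.IsAlgClosed.Basic
import Mathlib.GroupTheory.Divisible
import Mathlib.Algebra.Group.TypeTags.Hom
import HarnessLib

/-!
# Characters with values in `Kˣ`, `K` algebraically closed, extend from subgroups

Topic `Literature/GroupTheory`.  Theorem-only file (no named fact, no new notion, no instance):

* `exists_units_pow_eq_of_isAlgClosed` — `Kˣ` is divisible: `vⁿ = u` is solvable for `n ≥ 1`;
* `exists_monoidHom_extend_of_isAlgClosed` — **for an abelian group `G`, a subgroup `H ≤ G` and
  an algebraically closed field `K`, every homomorphism `φ : H →* Kˣ` extends to `Φ : G →* Kˣ`**: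
  `Kˣ` is a divisible abelian group, hence an injective `ℤ`-module (Baer's criterion, Mathlib
  `Module.Baer.of_divisible`, `Module.Baer.extension_property_addMonoidHom`), transported along
  `Additive`/`Multiplicative`.

(The exactness of `Hom(-, Kˣ)` on abelian groups; used to extend square roots of `p`-adic characters
from open subgroups.)

## References

* C. A. Weibel, *An Introduction to Homological Algebra* (1994), §2.3 (Baer's criterion 2.3.1;
  divisible abelian groups are injective, Cor. 2.3.2). [Weibel1994]
-/

namespace Literature.GroupTheory

/-- **`Kˣ` is divisible for `K` algebraically closed**: for `u ∈ Kˣ` and `n ≥ 1` there is `v ∈ Kˣ`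
with `vⁿ = u` (a root of `Xⁿ - u`, non-zero since `u ≠ 0`). [folklore] -/
theorem exists_units_pow_eq_of_isAlgClosed {K : Type*} [Field K] [IsAlgClosed K] (u : Kˣ) {n : ℕ}
    (hn : 0 < n) : ∃ v : Kˣ, v ^ n = u := by
  obtain ⟨z, hz⟩ := IsAlgClosed.exists_pow_nat_eq (u : K) hn
  have hz0 : z ≠ 0 := by
    rintro rfl
    rw [zero_pow hn.ne'] at hz
    exact u.ne_zero hz.symm
  exact ⟨Units.mk0 z hz0, Units.ext (by rw [Units.val_pow_eq_pow_val, Units.val_mk0, hz])⟩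

/-- **Characters into `Kˣ` (`K` algebraically closed) extend from subgroups of abelian groups.**
For `G` abelian, `H ≤ G` and `φ : H →* Kˣ` there is `Φ : G →* Kˣ` with `Φ|_H = φ`: `Kˣ` is
divisible (`exists_units_pow_eq_of_isAlgClosed`), so `Additive Kˣ` is a divisible, hence injective,
`ℤ`-module (Baer), and the additive shadow of `φ` extends along `Additive H ↪ Additive G`.
[cite: Weibel1994, §2.3, Cor. 2.3.2] -/
theorem exists_monoidHom_extend_of_isAlgClosed {G : Type*} [CommGroup G] (H : Subgroup G)
    {K : Type*} [Field K] [IsAlgClosed K] (φ : H →* Kˣ) :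
    ∃ Φ : G →* Kˣ, ∀ x : H, Φ x = φ x := by
  classical
  -- `Additive Kˣ` is `ℤ`-divisible
  have hsurj : ∀ {n : ℤ}, n ≠ 0 → Function.Surjective (fun a : Additive Kˣ => n • a) := by
    intro n hn a
    rcases Int.natAbs_eq n with hm | hm
    · have hm0 : 0 < n.natAbs := Int.natAbs_pos.2 hn
      obtain ⟨v, hv⟩ := exists_units_pow_eq_of_isAlgClosed (Additive.toMul a) hm0
      refine ⟨Additive.ofMul v, ?_⟩
      change n • Additive.ofMul v = a
      rw [hm, natCast_zsmul, ← ofMul_pow, hv]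
      rfl
    · have hm0 : 0 < n.natAbs := Int.natAbs_pos.2 hn
      obtain ⟨v, hv⟩ := exists_units_pow_eq_of_isAlgClosed (Additive.toMul a)⁻¹ hm0
      refine ⟨Additive.ofMul v, ?_⟩
      change n • Additive.ofMul v = a
      rw [hm, neg_zsmul, natCast_zsmul, ← ofMul_pow, hv, ← ofMul_inv, inv_inv]
      rfl
  letI : DivisibleBy (Additive Kˣ) ℤ := divisibleByOfSMulRightSurj (Additive Kˣ) ℤ hsurj
  have hB : Module.Baer ℤ (Additive Kˣ) := Module.Baer.of_divisible _
  have hinj : Function.Injective (MonoidHom.toAdditive H.subtype) := fun a b hab =>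
    Additive.toMul.injective (H.subtype_injective (Additive.ofMul.injective hab))
  obtain ⟨h, hh⟩ := hB.extension_property_addMonoidHom (MonoidHom.toAdditive H.subtype) hinj
    (MonoidHom.toAdditive φ)
  refine ⟨MonoidHom.toAdditive.symm h, fun x => ?_⟩
  have hx := DFunLike.congr_fun hh (Additive.ofMul x)
  rw [AddMonoidHom.comp_apply] at hx
  exact congrArg Additive.toMul hx

end Literature.GroupTheory
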